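import Summits.QuantumFields.QCD.Theses.NestedDissectionSea
import Summits.QuantumFields.QCD.Theorems.CoerciveSea.Negative.PinWindow
import Summits.QuantumFields.QCD.Theorems.NestedDissectionSeaKineticEdge
import Literature.MathematicalPhysics.QuantumLattice.TopologicalCriticalMass

/-!
# Crux `EarlyCrosserLaw` (stmt-QuantumFields-13995), line `cells-inherit-torus-extinction` — small boxes and the
# outer union bound (composition helpers of the lead skeleton v2, lead c2)

Sorry-free, standard axioms. Three deterministic facts used by the composition `EarlyCrosserLaw_of` of the line
skeleton (`Cruxes/EarlyCrosserLaw/Lines/cells_inherit_torus_extinction.lean`, v2) to absorb every box below a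
fixed size and to add window laws over populations and boxes:

* `eventually_neg_lt_valenceMass` — on the PHYSICAL BRANCH (`mcrit k → 0`) every valence mass
  `m_f(k) = mcrit k + a_k m_f/Z_m k` is eventually above any fixed negative level (`a_k/Z_m → 0`, landed
  `CoerciveSeaNegative.tendsto_a_div_Zm`);
* `crossing_impossible_of_side_lt` — a box with a side `< S₀` is empty (`side ≤ 1`) or has kinetic floor
  `> 1 − cos(π/S₀)` (landed kinetic edge `KineticEdge.kineticEdge_zeroMode`), so its Dirichlet cell is non-singular
  at every bare mass `μ' > −(1 − cos(π/S₀))`, for every gauge field; `kineticFloor_pos`: that floor is `> 0` for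
  `S₀ ≥ 2`;
* `outer_union_bound` — integrable majorants of finitely many events bound the phase-quenched OUTER probability of
  any event they cover, with no measurability of the covered event (Bochner conventions, `x/0 = 0`).
[folklore]
-/

noncomputable section

open Matrix Complex Filter MeasureTheory
open Literature.MathematicalPhysics.QuantumLattice Literature.MathematicalPhysics.QuantumFieldTheory
  Literature.Probability.LatticeModels

namespace Summit.QuantumFields.QCD.Cruxes.EarlyCrosserLaw.CellsInheritTorusExtinction

open scoped BigOperators

/-- **On the physical branch every valence mass is eventually above any fixed negative level**:
`mcrit k → 0` and `a_k/Z_m(k) → 0` (`CoerciveSeaNegative.tendsto_a_div_Zm`, `HasMassScaling`, `N_f ≤ 16`) give, for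
every `κ > 0`, eventually `-κ < mcrit k + a_k m_f/Z_m k` for all flavours at once. [folklore] -/
theorem eventually_neg_lt_valenceMass {Nf : ℕ} (hNf : Nf ≤ 16) (reg : QCDRegularisation Nf)
    (hms : reg.HasMassScaling) (hcrit : Tendsto reg.mcrit atTop (nhds 0)) (m : Fin Nf → ℝ)
    {κ : ℝ} (hκ : 0 < κ) :
    ∀ᶠ k : ℕ in atTop, ∀ f : Fin Nf, -κ < reg.mcrit k + reg.a k * m f / reg.Zm k := by
  have haz := Summit.QuantumFields.QCD.Theorems.CoerciveSeaNegative.tendsto_a_div_Zm reg hms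
    (Summit.QuantumFields.QCD.Theorems.CoerciveSeaNegative.massExponent_pos hNf)
  have hf : ∀ f : Fin Nf, ∀ᶠ k : ℕ in atTop, -κ < reg.mcrit k + reg.a k * m f / reg.Zm k := by
    intro f
    have h1 := haz.mul_const (m f)
    rw [zero_mul] at h1
    have h2 := hcrit.add h1
    rw [add_zero] at h2
    have h3 : Tendsto (fun k => reg.mcrit k + reg.a k * m f / reg.Zm k) atTop (nhds 0) :=
      h2.congr fun k => by ring
    exact h3.eventually (lt_mem_nhds (by linarith))
  exact Filter.eventually_all.mpr hf

/-- **Small boxes carry no crossing near the physical line** (deterministic, every gauge field): if some side of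
the box `(x, t)` is `< S₀` and `μ' > -(1 - cos(π/S₀))`, the Dirichlet cell `wilsonCell U μ' x t` is non-singular —
a side `≤ 1` makes the box empty, and for a side `t_i ∈ [2, S₀)` the kinetic edge
(`KineticEdge.kineticEdge_zeroMode`: a crossing at `μ'` needs `Σ_i (1 - cos(π/t_i)) ≤ -μ'`) is violated by the
`i`-th summand alone. [folklore] -/
theorem crossing_impossible_of_side_lt {N : ℕ} [NeZero N] (U : GaugeConfig 4 N SU3) (x : TorusSite 4 N)
    (t : Fin 4 → ℕ) (htN : ∀ i, t i ≤ N) {S₀ : ℕ} {i₀ : Fin 4} (hi₀ : t i₀ < S₀) {μ' : ℝ}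
    (hμ' : -(1 - Real.cos (Real.pi / S₀)) < μ') : (wilsonCell U μ' x t).det ≠ 0 := by
  classical
  intro hdet
  obtain ⟨w, hw0, hw⟩ := Matrix.exists_mulVec_eq_zero_iff.mpr hdet
  -- a side `≤ 1` makes the box empty, so `w = 0`
  rcases Nat.lt_or_ge (t i₀) 2 with hsmall | h2
  · apply hw0
    funext q
    exact absurd (q.2 i₀).2 (by have := (q.2 i₀).1; omega)
  -- otherwise the kinetic edge bounds `-μ'` from below
  have hedge := Summit.QuantumFields.QCD.Theorems.KineticEdge.kineticEdge_zeroMode U t μ' x htN hdet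
  have hti₀pos : (0 : ℝ) < t i₀ := by exact_mod_cast (lt_of_lt_of_le (by norm_num) h2)
  have hcos : Real.cos (Real.pi / t i₀) ≤ Real.cos (Real.pi / S₀) := by
    apply Real.cos_le_cos_of_nonneg_of_le_pi
    · positivity
    · rw [div_le_iff₀ hti₀pos]
      have : (1 : ℝ) ≤ t i₀ := by exact_mod_cast (le_trans (by norm_num) h2)
      nlinarith [Real.pi_pos]
    · exact div_le_div_of_nonneg_left Real.pi_pos.le hti₀pos (by exact_mod_cast hi₀.le)
  have hsum : 1 - Real.cos (Real.pi / t i₀) ≤ ∑ i, (1 - Real.cos (Real.pi / t i)) :=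
    Finset.single_le_sum (f := fun i => 1 - Real.cos (Real.pi / t i))
      (fun i _ => sub_nonneg.mpr (Real.cos_le_one _)) (Finset.mem_univ i₀)
  linarith

/-- The kinetic floor `1 - cos(π/S₀)` of a side below `S₀` is positive for `S₀ ≥ 2`. [folklore] -/
theorem kineticFloor_pos {S₀ : ℕ} (h : 2 ≤ S₀) : 0 < 1 - Real.cos (Real.pi / S₀) := by
  have hS : (2 : ℝ) ≤ S₀ := by exact_mod_cast h
  have hSpos : (0 : ℝ) < S₀ := by linarith
  have h1 : 0 < Real.pi / S₀ := div_pos Real.pi_pos hSpos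
  have h2 : Real.pi / S₀ ≤ Real.pi / 2 := div_le_div_of_nonneg_left Real.pi_pos.le (by norm_num) hS
  have h3 : Real.cos (Real.pi / S₀) < 1 := by
    rw [← Real.cos_zero]
    exact Real.cos_lt_cos_of_nonneg_of_le_pi_div_two le_rfl h2 h1
  linarith

open scoped Classical in
/-- **Outer union bound.** If every event `A i` of a finite family is majorised at level `δ i` under the weight
`wt ≥ 0` (a non-negative `g i ≥ 1_{A i}` with `g i · wt` integrable and `∫ g i wt / ∫ wt ≤ δ i`), then every event
`E` covered by the family has phase-quenched (outer) probability `≤ Σ δ i` — no measurability of `E` is needed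
(monotonicity of the Bochner integral against an integrable majorant; a non-integrable numerator is the junk `0`;
`x / 0 = 0`). [folklore] -/
theorem outer_union_bound {Ω : Type*} [MeasurableSpace Ω] {μW : Measure Ω} {wt : Ω → ℝ}
    (hwt : ∀ U, 0 ≤ wt U) {ι : Type*} [Fintype ι] {A : ι → Ω → Prop} {δ : ι → ℝ}
    (hA : ∀ i, ∃ g : Ω → ℝ, (∀ U, 0 ≤ g U) ∧ (∀ U, A i U → 1 ≤ g U) ∧
      Integrable (fun U => g U * wt U) μW ∧ (∫ U, g U * wt U ∂μW) / (∫ U, wt U ∂μW) ≤ δ i)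
    {E : Ω → Prop} (hE : ∀ U, E U → ∃ i, A i U) :
    (∫ U, (if E U then (1 : ℝ) else 0) * wt U ∂μW) / (∫ U, wt U ∂μW) ≤ ∑ i, δ i := by
  choose g hg0 hg1 hgi hgb using hA
  have hZ : 0 ≤ ∫ U, wt U ∂μW := integral_nonneg hwt
  have hGi : Integrable (fun U => ∑ i, g i U * wt U) μW := integrable_finsetSum _ fun i _ => hgi i
  have hmono : ∫ U, (if E U then (1 : ℝ) else 0) * wt U ∂μW ≤ ∫ U, ∑ i, g i U * wt U ∂μW := by
    refine integral_mono_of_nonneg (Eventually.of_forall fun U => ?_) hGi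
      (Eventually.of_forall fun U => ?_)
    · show (0 : ℝ) ≤ (if E U then (1 : ℝ) else 0) * wt U
      have h01 : (0 : ℝ) ≤ (if E U then (1 : ℝ) else 0) := by split_ifs <;> norm_num
      exact mul_nonneg h01 (hwt U)
    · show (if E U then (1 : ℝ) else 0) * wt U ≤ ∑ i, g i U * wt U
      rw [← Finset.sum_mul]
      refine mul_le_mul_of_nonneg_right ?_ (hwt U)
      split_ifs with hU
      · obtain ⟨i, hi⟩ := hE U hU
        exact le_trans (hg1 i U hi) (Finset.single_le_sum (fun j _ => hg0 j U) (Finset.mem_univ i))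
      · exact Finset.sum_nonneg fun j _ => hg0 j U
  calc (∫ U, (if E U then (1 : ℝ) else 0) * wt U ∂μW) / (∫ U, wt U ∂μW)
      ≤ (∫ U, ∑ i, g i U * wt U ∂μW) / (∫ U, wt U ∂μW) := div_le_div_of_nonneg_right hmono hZ
    _ = ∑ i, (∫ U, g i U * wt U ∂μW) / (∫ U, wt U ∂μW) := by
        rw [integral_finsetSum _ (fun i _ => hgi i), Finset.sum_div]
    _ ≤ ∑ i, δ i := Finset.sum_le_sum fun i _ => hgb i

end Summit.QuantumFields.QCD.Cruxes.EarlyCrosserLaw.CellsInheritTorusExtinction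

end
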